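/-
Copyright (c) 2026 the pub-hodgecm-mathlib formalisation cell (harness21).  Typer∕survey seat hodgecm-mathlib-typ-T5b (g0), topic T5 = P8
«(C♯)hol interior», 2026-08-31.  KERNEL module: THEOREMS ONLY (no definition, no named fact, no instance, no notation, no `sorry`).
-/
import Literature.NumberTheory.Automorphic.UnitaryGroupCohomologicalForms
import Literature.NumberTheory.Automorphic.UnitaryGroupArchCenter
import HarnessLib

/-!
# The archimedean centre acts trivially on holomorphic cotangent forms — «`χ_∞ = 1`» for `H¹`-cohomological `P`

Topic `NumberTheory/Automorphic`; namespace `Literature.NumberTheory.Automorphic.UnitaryGroup.CotangentForms` (that of ★ `holCotForms`).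
THEOREMS ONLY.  Cell hodgecm-mathlib FLOOR 0, programme P2, topic T5 = P8 (interior of letter #87 (C♯)hol along [Liu2021, Prop. 4.13
proof Case 1]): node **B4** of `F0/P2/T5a-TREE.md` v2 («`χ̃_∞ = 1` from hol-cotangent: the centre acts trivially on cotangent values») ∕
node K1h of `F0/P2/T5b-TREE.md` — Liu's «Note that the central character `χ` of `π` satisfies `χ_∞ = 1`» (FJcycle.tex l. 2137; Camb. J.
Math. 9 (2021) p. 48), for the tree's honest objects: the frame `(ι, H, T)` of (C♯)hol, the holomorphic cotangent forms ★ `holCotForms L⁺ L c̄ 3 H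
(cmArchSection L ι H T hT) (cmCompactFactor L ι H T hT)` and the archimedean centre `y ↦ y · 1₃`, `y ∈ U(1)(L⁺ ⊗ ℝ)` (★ `cmArchCenter`).

THE MATHEMATICS ([BorelJacquet1979, §4.1]: `G(𝔸) = G_∞ × G(𝔸_f)`, `G_∞ = ∏_v G(F_v)`; [Borel1997, §5.14]: forms of `K`-type `τ` read on
the group, `f(gk) = τ(k)⁻¹ f(g)`; [Helgason1978, Ch. VIII §7]: the isotropy representation).  Write the archimedean central element
`g_∞ = y · 1₃ ∈ U(H)(L ⊗ ℝ)`.  Its component at the place of `ι`, read in the `U(2,1)`-coordinates of the frame, is the SCALAR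
`u = π_ι(g_∞) = λ · 1₃`, `λ = ι(y)` (`T⁻¹ (λ·1) T = λ·1`; §2), and `g_∞ = σ(u) · k` with `σ = cmArchSection` the section at `ι` and `k` in the
compact factor `K_c = cmCompactFactor` (the archimedean elements with trivial `ι`-component; §3).  A holomorphic cotangent form `Φ` is
right `K_c`-invariant and of right `K_∞`-type the cotangent isotropy representation `k ↦ ᵗD(k)(x₀)` along `σ` (★ `holCotForms`, ★
`BallForms.cotangentCocycle`); a scalar acts TRIVIALLY on the ball (`(λ·1)·(z,1) = λ (z,1)`), so its Jacobian is the identity (§1) and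
`Φ(x · (y·1₃, 1)) = Φ(x · σ(u)) = ᵗD(u)(x₀) Φ(x) = Φ(x)` (§4).  Consequently the `L²`-classes of the coordinates of `Φ` are FIXED by
`R((y,1) · 1₃)` (§5), and any central character `ψ_P` of a discrete automorphic `P` (★ `DiscreteAutomorphicRep.exists_centralCharacter_adelicCenter`,
sibling module `UnitaryGroupDiscreteRepCentralCharacter`) containing such a form with a non-zero coordinate class takes the value `1` on the
archimedean centre: `ψ_P((y, 1)) = 1` — «`χ_∞ = 1`».

* §1 `Jac_eq_one_of_mat_eq_smul`, `smul_eq_self_of_mat_eq_smul` — a scalar `λ · 1₃ ∈ U(2,1)` acts as the identity of `𝔹²`, with identity Jacobian;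
* §2 (private) `exists_mat_archProjU21EmbCM_cmArchCenter` — `π_ι(y · 1₃)` is a scalar matrix (= ★ `mat_archProjU21EmbCM_cmArchCenter` of
  `UnitaryGroupArchIsotropyCenter`, re-derived in ten lines so that this module does not import the `archKappa` lane);
* §3 `archToAdelic_cmArchCenter_eq_cmArchSection_mul` — `(y·1₃, 1) = cmArchSection(π_ι(y·1₃)) · k`, `k ∈ cmCompactFactor`;
* §4 **`apply_mul_archToAdelic_cmArchCenter`** — `Φ (x · (y·1₃, 1)) = Φ x` for every `Φ ∈ holCotForms … (cmArchSection …) (cmCompactFactor …)`;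
* §5 **`rightRegular_archCentre_toLp_toQuotFun`** — `R((y,1)·1₃) [Φ_j] = [Φ_j]` on the `L²`-classes of the coordinates, and
  **`centralCharacter_archCentre_eq_one`** — `ψ((y,1)) = 1` for every `ψ` through which the centre ★ `adelicCenter` acts on a `P` containing the
  coordinates of such a `Φ` with one non-zero class (the B4 conclusion; the non-vanishing of the class of a non-zero form is the consumer's
  continuity∕positivity input, e.g. the crux pin's `toLp_toQuotFun_ne_zero_of_mem_cohForms`).

HONEST SCOPE.  Nothing here is specific to [Liu2021] or to theta series; no statement about the FINITE part of the central character (node B3);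
the passage from `IsHolCotangentAt` («some non-zero `Φ`») to «some non-zero CLASS» is not made here (it needs continuity of `Φ` and positivity of
`μ` on open sets, available at the crux pin, not for the abstract automorphic measure).  HC_CM is proved only modulo the printed citations until
rung 0 closes; this file books nothing and discharges nothing booked (it pays an in-house node).

## References
* [BorelJacquet1979] A. Borel, H. Jacquet, *Automorphic forms and automorphic representations*, PSPM 33.1 (1979), §4.1, §4.6.
* [Borel1997] A. Borel, *Automorphic forms on SL₂(ℝ)*, Cambridge Tracts 130 (1997), §5.14.
* [Helgason1978] S. Helgason, *Differential Geometry, Lie Groups, and Symmetric Spaces* (1978), Ch. VIII §7 (isotropy representation).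
* [Liu2021] Y. Liu, Camb. J. Math. 9 (2021), proof of Prop. 4.13 Case 1, l. 2137 («`χ_∞ = 1`»).
-/

set_option autoImplicit false

noncomputable section

open NumberField NumberField.InfinitePlace NumberField.mixedEmbedding MulAction MeasureTheory
open scoped ComplexConjugate ComplexOrder Matrix

namespace Literature.NumberTheory.Automorphic.UnitaryGroup.CotangentForms

open Literature.AlgebraicGeometry.ShimuraVarieties
open Literature.Geometry.ComplexHyperbolic Literature.Geometry.ComplexHyperbolic.BallModel
open Literature.NumberTheory.Automorphic.AutomorphyFactor

/-! ## §1 A scalar element of `U(2,1)` is the identity of the ball, with identity Jacobian -/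

/-- `g · (z, 1) = λ (z, 1)` coordinatewise when `mat g = λ · 1₃`. [folklore] -/
private theorem W3_of_mat_eq_smul (g : U21) {l : ℂ} (hg : mat g = l • (1 : Matrix (Fin 3) (Fin 3) ℂ)) (z : Ball) (k : Fin 3) :
    W3 g z k = l * lift z k := by
  show (mat g *ᵥ lift z) k = _
  rw [hg, Matrix.smul_mulVec, Matrix.one_mulVec, Pi.smul_apply, smul_eq_mul]

/-- the scalar of a scalar element of `U(2,1)` is non-zero. [folklore] -/
private theorem ne_zero_of_mat_eq_smul (g : U21) {l : ℂ} (hg : mat g = l • (1 : Matrix (Fin 3) (Fin 3) ℂ)) : l ≠ 0 := by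
  intro h0
  apply det_mat_ne_zero g
  rw [hg, h0, zero_smul]
  exact Matrix.det_zero

/-- **Scalars act on the ball with identity Jacobian**: if `mat g = λ · 1₃` then `D(g)(z) = 1₂` at every point of the ball
(`g · (z, 1) = λ (z, 1)`, so `z ↦ g • z` is the identity map of `𝔹²`). [cite: Helgason1978, Ch. VIII §7] -/
theorem Jac_eq_one_of_mat_eq_smul (g : U21) {l : ℂ} (hg : mat g = l • (1 : Matrix (Fin 3) (Fin 3) ℂ)) (z : Ball) :
    Jac g z = 1 := by
  have hl : l ≠ 0 := ne_zero_of_mat_eq_smul g hg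
  have hW := W3_of_mat_eq_smul g hg z
  have h2 : W3 g z 2 = l := by rw [hW]; simp
  ext i j
  simp only [Jac, Matrix.of_apply, h2, hW, hg, Matrix.smul_apply, smul_eq_mul]
  fin_cases i <;> fin_cases j <;> simp <;> field_simp

/-- **Scalars act trivially on the ball**: if `mat g = λ · 1₃` then `g • z = z`. [cite: Helgason1978, Ch. VIII §7] -/
theorem smul_eq_self_of_mat_eq_smul (g : U21) {l : ℂ} (hg : mat g = l • (1 : Matrix (Fin 3) (Fin 3) ℂ)) (z : Ball) :
    g • z = z := by
  have hl : l ≠ 0 := ne_zero_of_mat_eq_smul g hg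
  have hW := W3_of_mat_eq_smul g hg z
  refine Ball.ext fun i => ?_
  rw [smul_val, hW, hW]
  have h2 : lift z 2 = 1 := by simp
  have hi : lift z (Fin.castSucc i) = z.1 i := by fin_cases i <;> rfl
  rw [h2, hi, mul_one, mul_div_cancel_left₀ _ hl]

/-! ## §2 The `ι`-component of the archimedean centre is a scalar of `U(2,1)` -/

section Frame

variable (L : Type) [Field L] [NumberField L] [IsCMField L] (ι : L →+* ℂ) (H : Matrix (Fin 3) (Fin 3) L) (T : GL (Fin 3) ℂ)
  (hT : (T : Matrix (Fin 3) (Fin 3) ℂ)ᴴ * H.map ι * (T : Matrix (Fin 3) (Fin 3) ℂ) = BallModel.J)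

/-- **`π_ι(y · 1₃)` is a scalar matrix** (`T⁻¹ (λ·1₃) T = λ·1₃`, `λ = ι(y)`) — ★ `mat_archProjU21EmbCM_cmArchCenter` of
`UnitaryGroupArchIsotropyCenter`, re-derived to keep this module's imports inside the cotangent-forms lane. [cite: BorelJacquet1979, §4.1] -/
private theorem exists_mat_archProjU21EmbCM_cmArchCenter (y : relNormOneInfUnits (↥(maximalRealSubfield L)) L) :
    ∃ l : ℂ, mat (archProjU21EmbCM L H ι T (formCongr_eq_of_conjTranspose L ι H T hT) (cmArchCenter L 3 H y)) =
      l • (1 : Matrix (Fin 3) (Fin 3) ℂ) := by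
  set l : ℂ := evalEmb L ι (isComplex_mk_of_isCMField L ι)
    (InfiniteAdeleRing.ringEquiv_mixedSpace L ((y : (InfiniteAdeleRing L)ˣ) : InfiniteAdeleRing L)) with hl
  refine ⟨l, ?_⟩
  have hX : (((archAtEmb _ L (IsCMField.complexConj L) 3 H ι (isComplex_mk_of_isCMField L ι)
      (complexConj_smul_infinitePlace L _) (IsCMField.complexConj_ne_one L) (cmArchCenter L 3 H y) :
        unitaryGroupOfForm (starRingEnd ℂ) (H.map ι)) : GL (Fin 3) ℂ) : Matrix (Fin 3) (Fin 3) ℂ) =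
      l • (1 : Matrix (Fin 3) (Fin 3) ℂ) := by
    ext i j
    rw [coe_archAtEmb_apply, cmArchCenter_eq, coe_archCenter, Matrix.smul_apply, Matrix.smul_apply, smul_eq_mul,
      smul_eq_mul, map_mul, hl]
    by_cases hij : i = j
    · subst hij; rw [Matrix.one_apply_eq, Matrix.one_apply_eq, map_one]
    · rw [Matrix.one_apply_ne hij, Matrix.one_apply_ne hij, map_zero]
  show (((archProjU21Emb _ L (IsCMField.complexConj L) H ι (isComplex_mk_of_isCMField L ι) T
      (formCongr_eq_of_conjTranspose L ι H T hT)
      (complexConj_smul_infinitePlace L _) (IsCMField.complexConj_ne_one L) (cmArchCenter L 3 H y) : U21) :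
        GL (Fin 3) ℂ) : Matrix (Fin 3) (Fin 3) ℂ) = _
  rw [coe_archProjU21Emb_apply, Units.val_mul, Units.val_mul, hX, Matrix.mul_smul, Matrix.mul_one, Matrix.smul_mul,
    Units.inv_mul]

/-! ## §3 The decomposition `(y·1₃, 1) = cmArchSection(π_ι(y·1₃)) · k`, `k ∈ cmCompactFactor` -/

/-- The CM section is `(its archimedean part, 1)`: `cmArchSection u = ((cmArchSection u)_∞, 1)`. [cite: BorelJacquet1979, §4.1] -/
theorem cmArchSection_eq_archToAdelic_archPart (u : U21) :
    cmArchSection L ι H T hT u =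
      archToAdelic (↥(maximalRealSubfield L)) L (IsCMField.complexConj L) 3 H
        (archPart (↥(maximalRealSubfield L)) L (IsCMField.complexConj L) 3 H (cmArchSection L ι H T hT u)) := by
  obtain ⟨a, ha⟩ : ∃ a, cmArchSection L ι H T hT u =
      archToAdelic (↥(maximalRealSubfield L)) L (IsCMField.complexConj L) 3 H a := ⟨_, rfl⟩
  rw [ha, archPart_archToAdelic]

/-- **The archimedean centre splits along the frame**: `(y·1₃, 1) = cmArchSection (π_ι(y·1₃)) · k` with `k` in the compact factor
`cmCompactFactor` (the archimedean elements with trivial `ι`-component) — `k = ((σ(u)_∞)⁻¹ · y·1₃, 1)`, whose `ι`-projection is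
`u⁻¹ u = 1` (★ `archProjU21EmbCM_archPart_archSectionU21CM`). [cite: BorelJacquet1979, §4.1] -/
theorem archToAdelic_cmArchCenter_eq_cmArchSection_mul (y : relNormOneInfUnits (↥(maximalRealSubfield L)) L) :
    ∃ k ∈ cmCompactFactor L ι H T hT,
      archToAdelic (↥(maximalRealSubfield L)) L (IsCMField.complexConj L) 3 H (cmArchCenter L 3 H y) =
        cmArchSection L ι H T hT
          (archProjU21EmbCM L H ι T (formCongr_eq_of_conjTranspose L ι H T hT) (cmArchCenter L 3 H y)) * k := by
  set g := cmArchCenter L 3 H y with hg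
  set u : U21 := archProjU21EmbCM L H ι T (formCongr_eq_of_conjTranspose L ι H T hT) g with hu
  set s := cmArchSection L ι H T hT u with hs
  set a := archPart (↥(maximalRealSubfield L)) L (IsCMField.complexConj L) 3 H s with ha
  have hsa : s = archToAdelic (↥(maximalRealSubfield L)) L (IsCMField.complexConj L) 3 H a :=
    cmArchSection_eq_archToAdelic_archPart L ι H T hT u
  have hproj : archProjU21EmbCM L H ι T (formCongr_eq_of_conjTranspose L ι H T hT) a = u :=
    archProjU21EmbCM_archPart_archSectionU21CM L ι H T hT u
  refine ⟨archToAdelic (↥(maximalRealSubfield L)) L (IsCMField.complexConj L) 3 H (a⁻¹ * g), ?_, ?_⟩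
  · rw [cmCompactFactor_eq]
    refine Subgroup.mem_map_of_mem _ ?_
    rw [MonoidHom.mem_ker, map_mul, map_inv, hproj, hu, inv_mul_cancel]
  · rw [map_mul, map_inv, ← hsa, mul_inv_cancel_left]

/-! ## §4 Holomorphic cotangent forms are invariant under the archimedean centre -/

/-- **`Φ (x · (y·1₃, 1)) = Φ x` for every holomorphic cotangent form `Φ`** of the archimedean factor `(cmArchSection, cmCompactFactor)`:
the compact part `k` of `(y·1₃, 1) = σ(u) · k` acts trivially (`K_c`-invariance), and the scalar `u = λ·1₃ ∈ Stab(x₀)` acts through the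
cotangent isotropy representation `ᵗD(u)(x₀) = 1` (§1). [cite: Borel1997, §5.14] [cite: Helgason1978, Ch. VIII §7] -/
theorem apply_mul_archToAdelic_cmArchCenter
    {Φ : (adelicGroupData (↥(maximalRealSubfield L)) L (IsCMField.complexConj L) 3 H).Adelic → (Fin 2 → ℂ)}
    (hΦ : Φ ∈ holCotForms (↥(maximalRealSubfield L)) L (IsCMField.complexConj L) 3 H (cmArchSection L ι H T hT)
      (cmCompactFactor L ι H T hT))
    (y : relNormOneInfUnits (↥(maximalRealSubfield L)) L)
    (x : (adelicGroupData (↥(maximalRealSubfield L)) L (IsCMField.complexConj L) 3 H).Adelic) :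
    Φ (x * archToAdelic (↥(maximalRealSubfield L)) L (IsCMField.complexConj L) 3 H (cmArchCenter L 3 H y)) = Φ x := by
  obtain ⟨hw, hKc, -, -⟩ := mem_holCotForms_iff.mp hΦ
  obtain ⟨k, hk, hdec⟩ := archToAdelic_cmArchCenter_eq_cmArchSection_mul L ι H T hT y
  obtain ⟨l, hl⟩ := exists_mat_archProjU21EmbCM_cmArchCenter L ι H T hT y
  set u : U21 := archProjU21EmbCM L H ι T (formCongr_eq_of_conjTranspose L ι H T hT) (cmArchCenter L 3 H y) with hu
  have hux : u ∈ stabilizer U21 x₀ := mem_stabilizer_iff.mpr (smul_eq_self_of_mat_eq_smul u hl x₀)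
  rw [hdec, ← mul_assoc, hKc k hk]
  have key := WeightForms.right_equiv hw ⟨u, hux⟩ x
  have hι : ((cmArchSection L ι H T hT).comp (stabilizer U21 x₀).subtype) ⟨u, hux⟩ = cmArchSection L ι H T hT u := rfl
  rw [hι] at key
  rw [key, IsPullbackCocycle.weightOf_inv_apply]
  show BallForms.cotangentCocycle u x₀ (Φ x) = Φ x
  rw [BallForms.cotangentCocycle_apply, Jac_eq_one_of_mat_eq_smul u hl x₀, Matrix.transpose_one, Matrix.one_mulVec]

/-! ## §5 «`χ_∞ = 1`»: the archimedean centre fixes the `L²`-classes of the coordinates; central characters are `1` on it -/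

variable {μ : Measure (adelicGroupData (↥(maximalRealSubfield L)) L (IsCMField.complexConj L) 3 H).automorphicQuotient}
  [SMulInvariantMeasure (adelicGroupData (↥(maximalRealSubfield L)) L (IsCMField.complexConj L) 3 H).Adelic
    (adelicGroupData (↥(maximalRealSubfield L)) L (IsCMField.complexConj L) 3 H).automorphicQuotient μ]

/-- A holomorphic cotangent form is left-invariant under `A_G · U(H)(L⁺)` (`A_G = 1` for the unitary datum), coordinatewise.
[cite: BorelJacquet1979, §4.2] -/
theorem left_inv_of_mem_holCotForms
    {Φ : (adelicGroupData (↥(maximalRealSubfield L)) L (IsCMField.complexConj L) 3 H).Adelic → (Fin 2 → ℂ)}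
    (hΦ : Φ ∈ holCotForms (↥(maximalRealSubfield L)) L (IsCMField.complexConj L) 3 H (cmArchSection L ι H T hT)
      (cmCompactFactor L ι H T hT)) (j : Fin 2) :
    ∀ γ ∈ (adelicGroupData (↥(maximalRealSubfield L)) L (IsCMField.complexConj L) 3 H).quotientSubgroup, ∀ g,
      (fun g => Φ g j) (γ * g) = (fun g => Φ g j) g := by
  intro γ hγ g
  obtain ⟨hw, -, -, -⟩ := mem_holCotForms_iff.mp hΦ
  have hγ' : γ ∈ (⊥ : Subgroup _) ⊔ (toAdelic (↥(maximalRealSubfield L)) L (IsCMField.complexConj L) 3 H).range := hγ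
  rw [bot_sup_eq] at hγ'
  show Φ (γ * g) j = Φ g j
  rw [WeightForms.left_inv hw hγ' g]

/-- **`R((y,1)·1₃) [Φ_j] = [Φ_j]`**: the archimedean central element fixes the `L²`-class of each coordinate of a holomorphic cotangent form
(`R(z)[f] = [f(z⁻¹ • ·)]`, Mathlib `DomMulAct.mk_smul_toLp`, and `[w] ↦ Φ_j(w⁻¹ z) = Φ_j(w⁻¹)` by §4). [cite: BorelJacquet1979, §4.6] -/
theorem rightRegular_archCentre_toLp_toQuotFun
    {Φ : (adelicGroupData (↥(maximalRealSubfield L)) L (IsCMField.complexConj L) 3 H).Adelic → (Fin 2 → ℂ)}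
    (hΦ : Φ ∈ holCotForms (↥(maximalRealSubfield L)) L (IsCMField.complexConj L) 3 H (cmArchSection L ι H T hT)
      (cmCompactFactor L ι H T hT))
    (y : relNormOneInfUnits (↥(maximalRealSubfield L)) L) (j : Fin 2)
    (h : MemLp (toQuotFun (adelicGroupData (↥(maximalRealSubfield L)) L (IsCMField.complexConj L) 3 H) fun g => Φ g j) 2 μ) :
    (adelicGroupData (↥(maximalRealSubfield L)) L (IsCMField.complexConj L) 3 H).rightRegular μ
        (archToAdelic (↥(maximalRealSubfield L)) L (IsCMField.complexConj L) 3 H (cmArchCenter L 3 H y)) (h.toLp _) =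
      h.toLp _ := by
  have hleft := left_inv_of_mem_holCotForms L ι H T hT hΦ j
  have hfun : (fun x : (adelicGroupData (↥(maximalRealSubfield L)) L (IsCMField.complexConj L) 3 H).automorphicQuotient =>
      toQuotFun (adelicGroupData (↥(maximalRealSubfield L)) L (IsCMField.complexConj L) 3 H) (fun g => Φ g j)
        ((archToAdelic (↥(maximalRealSubfield L)) L (IsCMField.complexConj L) 3 H (cmArchCenter L 3 H y))⁻¹ • x)) =
      toQuotFun (adelicGroupData (↥(maximalRealSubfield L)) L (IsCMField.complexConj L) 3 H) (fun g => Φ g j) := by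
    funext x
    have hsurj : Function.Surjective
        (adelicGroupData (↥(maximalRealSubfield L)) L (IsCMField.complexConj L) 3 H).toAutomorphicQuotient :=
      QuotientGroup.mk_surjective
    obtain ⟨w, rfl⟩ := hsurj x
    show toQuotFun (adelicGroupData (↥(maximalRealSubfield L)) L (IsCMField.complexConj L) 3 H) (fun g => Φ g j)
        ((adelicGroupData (↥(maximalRealSubfield L)) L (IsCMField.complexConj L) 3 H).toAutomorphicQuotient
          ((archToAdelic (↥(maximalRealSubfield L)) L (IsCMField.complexConj L) 3 H (cmArchCenter L 3 H y))⁻¹ * w)) = _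
    rw [toQuotFun_mk hleft, toQuotFun_mk hleft, mul_inv_rev, inv_inv]
    show Φ (w⁻¹ * archToAdelic (↥(maximalRealSubfield L)) L (IsCMField.complexConj L) 3 H (cmArchCenter L 3 H y)) j = Φ w⁻¹ j
    rw [apply_mul_archToAdelic_cmArchCenter L ι H T hT hΦ y w⁻¹]
  rw [AdelicGroupData.rightRegular_apply, DomMulAct.mk_smul_toLp]
  exact MemLp.toLp_congr _ _ (Filter.EventuallyEq.of_eq hfun)

/-- **«`χ_∞ = 1`» [Liu2021, l. 2137]: a central character of `P` is trivial on the archimedean centre as soon as `P` contains the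
coordinates of a holomorphic cotangent form with a non-zero class.**  If the centre `u ↦ u · 1₃` (★ `adelicCenter`) acts on the
discrete automorphic `P` through `ψ` (★ `DiscreteAutomorphicRep.exists_centralCharacter_adelicCenter`), `Φ ∈ holCotForms …` has its
coordinate classes in `P` (★ `ContainsForm`) and one of them is non-zero, then `ψ((y, 1)) = 1` for every archimedean norm-one unit `y`
(`(y·1₃, 1) = (y,1)·1₃`, ★ `archToAdelic_cmArchCenter`). [cite: Liu2021, proof of Prop. 4.13 Case 1, l. 2137] [cite: BorelJacquet1979, §4.6] -/
theorem centralCharacter_archCentre_eq_one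
    (P : DiscreteAutomorphicRep (adelicGroupData (↥(maximalRealSubfield L)) L (IsCMField.complexConj L) 3 H) μ)
    {ψ : ↥(adelicOne (↥(maximalRealSubfield L)) L (IsCMField.complexConj L)) →* ℂˣ}
    (hψ : ∀ (u : ↥(adelicOne (↥(maximalRealSubfield L)) L (IsCMField.complexConj L))) (f : P.space.toSubmodule),
      P.space.toContRep (adelicCenter (↥(maximalRealSubfield L)) L (IsCMField.complexConj L) 3 H u) f = ((ψ u : ℂˣ) : ℂ) • f)
    {Φ : (adelicGroupData (↥(maximalRealSubfield L)) L (IsCMField.complexConj L) 3 H).Adelic → (Fin 2 → ℂ)}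
    (hΦ : Φ ∈ holCotForms (↥(maximalRealSubfield L)) L (IsCMField.complexConj L) 3 H (cmArchSection L ι H T hT)
      (cmCompactFactor L ι H T hT))
    {j : Fin 2} (h : MemLp (toQuotFun (adelicGroupData (↥(maximalRealSubfield L)) L (IsCMField.complexConj L) 3 H) fun g => Φ g j) 2 μ)
    (hmem : h.toLp _ ∈ P.space.toSubmodule) (hne : h.toLp _ ≠ 0)
    (y : relNormOneInfUnits (↥(maximalRealSubfield L)) L) :
    ψ ((cmAdelicOneEquivRelNormOne L).symm (relNormOneInfToIdeles (↥(maximalRealSubfield L)) L y)) = 1 := by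
  have hfix := rightRegular_archCentre_toLp_toQuotFun L ι H T hT (μ := μ) hΦ y j h
  rw [archToAdelic_cmArchCenter] at hfix
  set u := (cmAdelicOneEquivRelNormOne L).symm (relNormOneInfToIdeles (↥(maximalRealSubfield L)) L y) with hu
  have hv : P.space.toContRep (adelicCenter (↥(maximalRealSubfield L)) L (IsCMField.complexConj L) 3 H u) ⟨_, hmem⟩ = ⟨_, hmem⟩ :=
    Subtype.ext hfix
  have hne' : (⟨_, hmem⟩ : P.space.toSubmodule) ≠ 0 := fun h0 => hne (congrArg Subtype.val h0)
  have hh := hψ u ⟨_, hmem⟩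
  rw [hv] at hh
  have h' : ((ψ u : ℂˣ) : ℂ) • (⟨_, hmem⟩ : P.space.toSubmodule) = (1 : ℂ) • ⟨_, hmem⟩ := by rw [one_smul]; exact hh.symm
  exact Units.ext (smul_left_injective ℂ hne' h')

end Frame

end Literature.NumberTheory.Automorphic.UnitaryGroup.CotangentForms

end
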